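import Summits.QuantumFields.BalabanUV.Beta.NVertexWoundFold

/-!
# `BalabanUV.Beta.NVertexWoundFoldAssembly` — row D1 ∕ (C1), PART 14b: **THE PERIODISED WOUND DOUBLE FOLD IS THE PRODUCT-FORM DOUBLE FOLD** — J-NOTE-7's exact
# torus identity (memo `HOME/b2b-balaban-beta-an2/gen67/J7-WINDING-OBSTRUCTION.md` §4; road FP A-1 to J-NOTE-7 l.67696: decision (R1) «wound rows»), assembled at
# the matrix level from PART 14a (`NVertexWoundFold`)

WHAT ([folklore] `tsum` ∕ `Finset` bookkeeping BY NAME; generic dimension `d`; no `def`, no `def … : Prop`, nothing cited, 0 sorry).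
`perF_dper_vertexOfK_eq_sum` (PART 11's single-source fold for ANY period-invariant decaying chart and ANY period-covariant bond-localised family — C2a∕C2b with the AN
letters replaced by hypotheses), `vertexOfK_sum_mul_family` (the chain-rule vertex is linear in the family over a finite weighted sum), `summable_col_mul_tsum_slice`,
`tsum_vertex2OfK_translate_eq` (the wound double vertex as a kernel), and **`perF_dper_tsum_vertex2OfK_translate`**: for a period-invariant decaying chart `K` on a box
`M = N·M′` and a local bi-stencil family `S₂` with JOINT period covariance,
`perF M (dper M (x z ↦ Σ'_d vertex2OfK K N S₂ μ y ν (y′ + M′∘d) x z)) = Σ_b Σ_β colN̂_{(μ,y)}(b) · colN̂_{(ν,y′)}(β) • perF M (dper M (x z ↦ Σ'_n S₂ b.2 b.1 β.2 (β.1 + M∘n) x z))`,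
`colN̂_{(μ,y)}(b) = (perF M K) ((b.1, inl b.2), (wrapPt M (N•y), inr μ))` — the two-source twin of PART 11 `perF_dper_vertexOfK_AN_eq_sum`; v4's `hQN₂ ∕ hHN₂` display
its `d = 0` term alone (J-NOTE-7).
WHAT THIS IS NOT: not instantiated at `WN = W2SymOfK (AN R j) …` (sectors `vertex2OfK ∕ mixOfK ∕ dM (K2OfK …)` on the road's v-next word); not the winding-limit lemma
(`d ≠ 0` terms → 0 as the box grows); no row of the END wrapper discharged or refuted; nothing of Bałaban's asserted, valued or discharged; 0 estimates; 0∕4 row-D1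
binders (hW, hR, D1Tel, D1Rep); ROOT M‴ p325680 ∕ P5c ∕ D6 untouched; NOT (C1), NOT (L2′), NOT D1, NEVER «G-an2-4 closed», NOT BetaPertH, NOT continuum, NOT Clay.

HONEST DEPENDENCY (page 1, mandatory): continuum YM on T⁴ ⇐ BetaPertH ∧ nine spine estimates (0/9 proved); BetaPertH ⇐ (D1) ∧ (D4) ∧ CAP+tail;
G-an2-4 gates asym, D1 and NE2/3/4.  HONEST FRAMING (cell contract, verbatim): «discharging `BetaPertH` makes Bałaban's UV stability UNCONDITIONAL —
a real constructive-QFT result; it is NOT the continuum limit and NOT the Clay problem.»  ABSOLUTE RULE (cell charter, verbatim): «No internally-minted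
statement may enter as a cited fact. Every hypothesis is either kernel-proved in this package or a verbatim quotation of a PUBLISHED theorem with page
reference. The manuscript(s) under audit are NOT citable for their own disputed steps — they are the thing under adjudication; programme-internal
(2001/route/tribunal) claims are never citable.»  Row D1 ∕ (C1) OWNER an2 (b2b-balaban-beta-an2) gen 67, 2026-08-27.  No existing file touched.
-/

noncomputable section

open scoped BigOperators

namespace Summit.QuantumFields.BalabanUV.Beta.NVertexWoundFoldAssembly


open Finset
open Literature.MathematicalPhysics.QuantumFieldTheory.Balaban1983to89
open Literature.MathematicalPhysics.QuantumFieldTheory.Balaban1983to89.Beta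
open B12Sec2to5 (l1 l1_nonneg)
open B4TorusKernel.MultiPeriod (translate translate_apply)
open B4Reflection242 (translate_translate)
open B4Sect5Proof (latticeConst latticeConst_nonneg)
open B6Lemma24Torus (pbox)
open ExpKernelCalculus (MKer Decays BiLoc shiftK summable_exp_shift l1_sub_symm)
open AffineAveraging (Site)
open OneStepResolventKernel (Fib wsum)
open OneStepKernelFamily (colH vertexOfK abs_colH_le)
open BalabanCompositeJets (LocStencil₂)
open SecondOrderResponse (vertex2OfK biLoc_vertexOfK_slice)
open Summit.QuantumFields.BalabanUV.Beta.FP.KernelPeriodisationFib (Idx perF perF_apply perZ perZ_apply perZ_translate_left perZ_translate_right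
  translate_eq_add)
open Summit.QuantumFields.BalabanUV.Beta.FP.KernelPeriodisationFibLoc (dper dper_apply summable_exp_l1_translate)
open Summit.QuantumFields.BalabanUV.Beta.FP.KernelPeriodisationFibTrace (tsum_sites_eq_sum_tsum)
open Summit.QuantumFields.BalabanUV.Beta.FP.TorusGaugeCovariancePairing (wrapPt wrapPt_coe)
open Summit.QuantumFields.BalabanUV.Beta.PeriodisedIndexLawSummable (abs_apply_le_of_biLoc)
open Summit.QuantumFields.BalabanUV.Beta.CombHId1Letters (vertexOfK_apply perZ_eq_tsum_translate_left abs_perZ_le_of_decays summable_col_mul_family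
  summable_of_translate_bound nsmul_translate perZ_coarse_col_eq_perF dper_vertexOfK_eq_sum)
open Summit.QuantumFields.BalabanUV.Beta.CombHId1Sandwich (perF_vertexOfK_dper_apply)

open Summit.QuantumFields.BalabanUV.Beta.NVertexWoundFold (tsum_slice_translate biLoc_tsum_slice tsum_vertexOfK_slice_translate tsum_vertex2OfK_translate_apply)

variable {d : ℕ} (M : Fin (d + 1) → ℕ) [∀ μ, NeZero (M μ)] {M' : Fin (d + 1) → ℕ} {N : ℕ}
  {K : MKer (d + 1) (Fib d)}

/-! ## §3 Assembly: the periodised wound double fold is the product-form double fold -/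

section Assembly

open ExpKernelCalculus (Zl Zl_nonneg)
open OneStepResolventKernel (biLoc_mono)
open OneStepKernelFamily (vertexFamily_vertexOfK)
open Summit.QuantumFields.BalabanUV.Beta.FP.KernelPeriodisationFib (perF_smul)
open Summit.QuantumFields.BalabanUV.Beta.FP.KernelPeriodisationFibLoc (decays_dper_diag)
open Summit.QuantumFields.BalabanUV.Beta.FP.PeriodisedBorderTables (dper_finset_sum_smul perF_finset_sum)
open Summit.QuantumFields.BalabanUV.Beta.CombHId1Letters (dper_vertexOfK)

variable {S : Fin (d + 1) → Site (d + 1) → MKer (d + 1) (Fib d)}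
  {S₂ : Fin (d + 1) → Site (d + 1) → Fin (d + 1) → Site (d + 1) → MKer (d + 1) (Fib d)}

/-- [folklore] **`perF_dper_vertexOfK_eq_sum` — PART 11's single-source fold for ANY period-invariant decaying chart and ANY period-covariant bond-localised
family** (C2a `dper_vertexOfK` + C2b `perF_vertexOfK_dper_apply` + `perZ_coarse_col_eq_perF`, the AN letters of PART 11 replaced by hypotheses):
`perF M (dper M (vertexOfK K N S μ y)) = Σ_b (perF M K) ((b.1, inl b.2), (wrapPt M (N•y), inr μ)) • perF M (dper M (S b.2 b.1))`. -/
theorem perF_dper_vertexOfK_eq_sum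
    (hKinv : ∀ (m x z : Site (d + 1)) (a b : Fib d), K (translate M x m) (translate M z m) a b = K x z a b)
    {CK δK CS δS : ℝ} (hK : Decays K CK δK) (hδK : 0 < δK)
    (hSt : ∀ (κ : Fin (d + 1)) (u m x z : Site (d + 1)) (a b : Fib d), S κ (translate M u m) (translate M x m) (translate M z m) a b = S κ u x z a b)
    (hS : ∀ κ u, BiLoc (S κ u) u u CS δS) (hδS : 0 < δS) (μ : Fin (d + 1)) (y : Site (d + 1)) :
    perF M (dper M (vertexOfK K N S μ y))
      = ∑ b : ↥(pbox M) × Fin (d + 1), perF M K (b.1, Sum.inl b.2) (wrapPt M ((N : ℤ) • y), Sum.inr μ)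
          • perF M (dper M (S b.2 (b.1 : Site (d + 1)))) := by
  have hCK : 0 ≤ CK := hK.nonneg (Sum.inl 0)
  have hCS : 0 ≤ CS := (hS 0 0).nonneg (Sum.inl 0)
  ext p q
  rw [dper_vertexOfK M hKinv hK hCK hδK hSt hS hCS hδS μ y, perF_vertexOfK_dper_apply M hKinv hK hδK hSt hS hδS μ y p q, Matrix.sum_apply,
    Fintype.sum_prod_type]
  refine Finset.sum_congr rfl fun u _ => Finset.sum_congr rfl fun κ _ => ?_
  rw [perZ_coarse_col_eq_perF M, Matrix.smul_apply, smul_eq_mul]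

/-- [folklore] **the chain-rule vertex is linear in the family over a finite weighted sum** (termwise summability displayed). -/
theorem vertexOfK_sum_mul_family {ι : Type*} (s : Finset ι) (c : ι → ℝ) (W : ι → Fin (d + 1) → Site (d + 1) → MKer (d + 1) (Fib d))
    (μ : Fin (d + 1)) (y : Site (d + 1))
    (hW : ∀ (i : ι) (κ : Fin (d + 1)) (x z : Site (d + 1)) (a b : Fib d),
      Summable fun u : Site (d + 1) => K u ((N : ℤ) • y) (Sum.inl κ) (Sum.inr μ) * W i κ u x z a b) :
    vertexOfK K N (fun κ u x z a b => ∑ i ∈ s, c i * W i κ u x z a b) μ y = ∑ i ∈ s, c i • vertexOfK K N (W i) μ y := by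
  funext x z a b
  rw [vertexOfK_apply]
  simp only [Finset.sum_apply, Pi.smul_apply, smul_eq_mul, vertexOfK_apply, Finset.mul_sum]
  have h1 : ∀ κ : Fin (d + 1),
      (∑' u : Site (d + 1), ∑ i ∈ s, K u ((N : ℤ) • y) (Sum.inl κ) (Sum.inr μ) * (c i * W i κ u x z a b))
        = ∑ i ∈ s, c i * ∑' u : Site (d + 1), K u ((N : ℤ) • y) (Sum.inl κ) (Sum.inr μ) * W i κ u x z a b := fun κ => by
    rw [Summable.tsum_finsetSum fun i _ => ((hW i κ x z a b).mul_left (c i)).congr fun u => by ring]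
    refine Finset.sum_congr rfl fun i _ => ?_
    rw [← tsum_mul_left]
    exact tsum_congr fun u => by ring
  simp only [h1]
  rw [Finset.sum_comm]

/-- [folklore] summability letter: the column weight times the second-bond-periodised slice family is summable in the first bond (the chart decays from the
source, the slice family is bounded by `C·K_{d+1}(δ)`). -/
theorem summable_col_mul_tsum_slice {CK δK C δ : ℝ} (hK : Decays K CK δK) (hδK : 0 < δK) (hS₂ : LocStencil₂ S₂ C δ) (hδ : 0 < δ)
    (β : ↥(pbox M) × Fin (d + 1)) (μ κ : Fin (d + 1)) (y x z : Site (d + 1)) (a b : Fib d) :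
    Summable fun u : Site (d + 1) => K u ((N : ℤ) • y) (Sum.inl κ) (Sum.inr μ)
      * ∑' n : Site (d + 1), S₂ κ u β.2 (translate M (β.1 : Site (d + 1)) n) x z a b := by
  have hCK : 0 ≤ CK := hK.nonneg (Sum.inl 0)
  have hC : 0 ≤ C := hS₂.nonneg
  refine ((ExpKernelCalculus.summable_exp_shift' hδK ((N : ℤ) • y)).mul_left (CK * (C * latticeConst (d + 1) δ))).of_norm_bounded fun u => ?_
  rw [Real.norm_eq_abs, abs_mul, show CK * (C * latticeConst (d + 1) δ) * Real.exp (-δK * l1 (u - (N : ℤ) • y))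
    = (CK * Real.exp (-δK * l1 (u - (N : ℤ) • y))) * (C * latticeConst (d + 1) δ) by ring]
  refine mul_le_mul (hK u _ _ _) ?_ (abs_nonneg _) (mul_nonneg hCK (Real.exp_pos _).le)
  have h := (biLoc_tsum_slice M hS₂ hδ β.2 (β.1 : Site (d + 1)) κ u) x z a b
  refine h.trans ?_
  have he : Real.exp (-δ * (l1 (x - u) + l1 (z - u))) ≤ 1 := by
    rw [Real.exp_le_one_iff]; exact mul_nonpos_of_nonpos_of_nonneg (neg_nonpos.mpr hδ.le) (add_nonneg (l1_nonneg _) (l1_nonneg _))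
  calc C * latticeConst (d + 1) δ * Real.exp (-δ * (l1 (x - u) + l1 (z - u)))
      ≤ C * latticeConst (d + 1) δ * 1 := mul_le_mul_of_nonneg_left he (mul_nonneg hC (latticeConst_nonneg _ hδ.le))
    _ = C * latticeConst (d + 1) δ := mul_one _

/-- [folklore] **`tsum_vertex2OfK_translate_eq` — THE WOUND DOUBLE VERTEX AS A KERNEL**: the chain-rule vertex over the column-weighted sum of the second-bond-periodised
slice families (§2 assembled at the kernel level). -/
theorem tsum_vertex2OfK_translate_eq (hM : ∀ i, M i = N * M' i)
    (hKinv : ∀ (m x z : Site (d + 1)) (a b : Fib d), K (translate M x m) (translate M z m) a b = K x z a b)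
    {CK δK C₂ : ℝ} (hK : Decays K CK δK) (hCK : 0 ≤ CK) (hδK : 0 < δK) (hS₂ : LocStencil₂ S₂ C₂ δK)
    (μ : Fin (d + 1)) (y : Site (d + 1)) (ν : Fin (d + 1)) (y' : Site (d + 1)) :
    (fun x z a c => ∑' dd : Site (d + 1), vertex2OfK K N S₂ μ y ν (translate M' y' dd) x z a c)
      = vertexOfK K N (fun κ u x z a c => ∑ β : ↥(pbox M) × Fin (d + 1), perF M K (β.1, Sum.inl β.2) (wrapPt M ((N : ℤ) • y'), Sum.inr ν)
          * ∑' n : Site (d + 1), S₂ κ u β.2 (translate M (β.1 : Site (d + 1)) n) x z a c) μ y := by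
  have hG : (fun κ u => fun x z a c => ∑' dd : Site (d + 1), vertexOfK K N (S₂ κ u) ν (translate M' y' dd) x z a c)
      = (fun κ u x z a c => ∑ β : ↥(pbox M) × Fin (d + 1), perF M K (β.1, Sum.inl β.2) (wrapPt M ((N : ℤ) • y'), Sum.inr ν)
          * ∑' n : Site (d + 1), S₂ κ u β.2 (translate M (β.1 : Site (d + 1)) n) x z a c) := by
    funext κ u x z a c
    exact tsum_vertexOfK_slice_translate M hM hKinv hK hCK hδK hS₂ hδK κ u ν y' x z a c
  funext x z a c
  rw [tsum_vertex2OfK_translate_apply M hM hK hCK hδK hS₂ μ y ν y' x z a c, hG]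

/-- [folklore] **`perF_dper_tsum_vertex2OfK_translate` — THE PERIODISED WOUND DOUBLE FOLD IS THE PRODUCT-FORM DOUBLE FOLD** (J-NOTE-7's exact torus identity, memo §4):
for a period-invariant decaying chart `K` on a box `M = N·M′` and a local bi-stencil family `S₂` with JOINT period covariance,
`perF M (dper M (x z ↦ Σ'_d vertex2OfK K N S₂ μ y ν (y′ + M′∘d) x z))
= Σ_b Σ_β (perF M K)((b♭),(wrapPt M (N•y), inr μ)) · (perF M K)((β♭),(wrapPt M (N•y′), inr ν)) • perF M (dper M (x z ↦ Σ'_n S₂ b.2 b.1 β.2 (β.1 + M∘n) x z))`. -/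
theorem perF_dper_tsum_vertex2OfK_translate (hM : ∀ i, M i = N * M' i)
    (hKinv : ∀ (m x z : Site (d + 1)) (a b : Fib d), K (translate M x m) (translate M z m) a b = K x z a b)
    {CK δK C₂ : ℝ} (hK : Decays K CK δK) (hCK : 0 ≤ CK) (hδK : 0 < δK) (hS₂ : LocStencil₂ S₂ C₂ δK)
    (hS₂t : ∀ (κ : Fin (d + 1)) (u : Site (d + 1)) (κ' : Fin (d + 1)) (u' m x z : Site (d + 1)) (a b : Fib d),
      S₂ κ (translate M u m) κ' (translate M u' m) (translate M x m) (translate M z m) a b = S₂ κ u κ' u' x z a b)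
    (μ : Fin (d + 1)) (y : Site (d + 1)) (ν : Fin (d + 1)) (y' : Site (d + 1)) :
    perF M (dper M (fun x z a c => ∑' dd : Site (d + 1), vertex2OfK K N S₂ μ y ν (translate M' y' dd) x z a c))
      = ∑ b : ↥(pbox M) × Fin (d + 1), ∑ β : ↥(pbox M) × Fin (d + 1),
          (perF M K (b.1, Sum.inl b.2) (wrapPt M ((N : ℤ) • y), Sum.inr μ) * perF M K (β.1, Sum.inl β.2) (wrapPt M ((N : ℤ) • y'), Sum.inr ν))
            • perF M (dper M (fun x z a c => ∑' n : Site (d + 1), S₂ b.2 (b.1 : Site (d + 1)) β.2 (translate M (β.1 : Site (d + 1)) n) x z a c)) := by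
  have hC₂ : 0 ≤ C₂ := hS₂.nonneg
  -- the slice families `W β κ u := Σ'_n S₂ κ u β.2 (β.1 + M∘n)`: period-covariant and bond-localised (§2)
  have hWt : ∀ (β : ↥(pbox M) × Fin (d + 1)) (κ : Fin (d + 1)) (u m x z : Site (d + 1)) (a b : Fib d),
      (fun κ u => fun x z a c => ∑' n : Site (d + 1), S₂ κ u β.2 (translate M (β.1 : Site (d + 1)) n) x z a c) κ (translate M u m)
          (translate M x m) (translate M z m) a b
        = (fun κ u => fun x z a c => ∑' n : Site (d + 1), S₂ κ u β.2 (translate M (β.1 : Site (d + 1)) n) x z a c) κ u x z a b :=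
    fun β κ u m x z a b => tsum_slice_translate M hS₂t κ u β.2 (β.1 : Site (d + 1)) m x z a b
  have hWl : ∀ (β : ↥(pbox M) × Fin (d + 1)) (κ : Fin (d + 1)) (u : Site (d + 1)),
      BiLoc ((fun κ u => fun x z a c => ∑' n : Site (d + 1), S₂ κ u β.2 (translate M (β.1 : Site (d + 1)) n) x z a c) κ u) u u
        (C₂ * latticeConst (d + 1) δK) δK := fun β κ u => biLoc_tsum_slice M hS₂ hδK β.2 (β.1 : Site (d + 1)) κ u
  -- (1) the wound kernel = the chain-rule vertex over the weighted slice families; (2) linearity in the family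
  have h2 : vertexOfK K N (fun κ u x z a c => ∑ β : ↥(pbox M) × Fin (d + 1), perF M K (β.1, Sum.inl β.2) (wrapPt M ((N : ℤ) • y'), Sum.inr ν)
          * ∑' n : Site (d + 1), S₂ κ u β.2 (translate M (β.1 : Site (d + 1)) n) x z a c) μ y
      = ∑ β : ↥(pbox M) × Fin (d + 1), perF M K (β.1, Sum.inl β.2) (wrapPt M ((N : ℤ) • y'), Sum.inr ν)
          • vertexOfK K N (fun κ u => fun x z a c => ∑' n : Site (d + 1), S₂ κ u β.2 (translate M (β.1 : Site (d + 1)) n) x z a c) μ y :=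
    vertexOfK_sum_mul_family Finset.univ (fun β : ↥(pbox M) × Fin (d + 1) => perF M K (β.1, Sum.inl β.2) (wrapPt M ((N : ℤ) • y'), Sum.inr ν))
      (fun (β : ↥(pbox M) × Fin (d + 1)) κ u => fun x z a c => ∑' n : Site (d + 1), S₂ κ u β.2 (translate M (β.1 : Site (d + 1)) n) x z a c) μ y
      (fun β κ x z a b => summable_col_mul_tsum_slice M hK hδK hS₂ hδK β μ κ y x z a b)
  rw [tsum_vertex2OfK_translate_eq M hM hKinv hK hCK hδK hS₂ μ y ν y', h2]
  -- (3) `dper` and `perF` are linear over the finite sum (each summand a bi-localised ∕ decaying kernel)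
  have hV : ∀ β : ↥(pbox M) × Fin (d + 1), ∃ Cv δv : ℝ, 0 ≤ Cv ∧ 0 < δv ∧
      BiLoc (vertexOfK K N (fun κ u => fun x z a c => ∑' n : Site (d + 1), S₂ κ u β.2 (translate M (β.1 : Site (d + 1)) n) x z a c) μ y)
        ((N : ℤ) • y) ((N : ℤ) • y) Cv δv := fun β => by
    have h := vertexFamily_vertexOfK (N := N) hK hCK (hWl β) hδK le_rfl μ y
    exact ⟨_, _, (h).nonneg (Sum.inl 0), half_pos hδK, h⟩
  rw [dper_finset_sum_smul M Finset.univ _ _ fun β _ => by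
      obtain ⟨Cv, δv, hCv, hδv, h⟩ := hV β; exact ⟨_, _, Cv, δv, hCv, hδv, h⟩,
    perF_finset_sum M Finset.univ _ fun β _ => by
      obtain ⟨Cv, δv, hCv, hδv, h⟩ := hV β
      refine ⟨|perF M K (β.1, Sum.inl β.2) (wrapPt M ((N : ℤ) • y'), Sum.inr ν)| * (Cv * latticeConst (d + 1) (δv / 2)), δv / 2, half_pos hδv, ?_⟩
      intro x z a b
      rw [Pi.smul_apply, Pi.smul_apply, Pi.smul_apply, Pi.smul_apply, smul_eq_mul, abs_mul, mul_assoc]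
      exact mul_le_mul_of_nonneg_left (decays_dper_diag M h hCv hδv x z a b) (abs_nonneg _)]
  -- (4) the single-source fold for each slice family, then regroup
  simp only [perF_smul, perF_dper_vertexOfK_eq_sum M hKinv hK hδK (hWt _) (hWl _) hδK μ y, Finset.smul_sum, smul_smul, mul_comm]
  rw [Finset.sum_comm]

end Assembly

end Summit.QuantumFields.BalabanUV.Beta.NVertexWoundFoldAssembly

end
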